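import Literature.NumberTheory.Weil1964.ArchFollandUnitaryPlaces
import Literature.NumberTheory.Weil1964.ArchPlaceUnitaryDiagonal
import Literature.NumberTheory.Weil1964.AdelicMetaplecticArchSection
import Literature.NumberTheory.Weil1964.ArchMetaplecticUnitarySplittingContinuity
import Literature.NumberTheory.Weil1964.ArchMetaplecticReindex
import Literature.NumberTheory.Weil1964.ArchMetaplecticQuotientCharacter
import Literature.NumberTheory.Weil1964.ArchDualPairThetaMajorants
import Literature.RepresentationTheory.KonnoKonno2007.RealUnitaryDualPairRelabel
import Literature.NumberTheory.Automorphic.UnitaryGroupSymplecticLocalization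
import HarnessLib

/-!
# The archimedean half of the Weil splitting of ONE adelic unitary group: `s_∞ : U(J)(F ⊗ ℝ) →* Mp_ψ(W_𝔸)ᶜᵒⁿᵗ`

Topic `NumberTheory/Weil1964`; namespace `Literature.NumberTheory.Weil1964`.  KERNEL MATHEMATICS ONLY: explicit definitions
with body and proved theorems; no `def … : Prop` record, no axiom, no proof hole.

For a DIAGONAL non-degenerate `F`-rational hermitian form `J = diag(t₀) ⊗ 1` over a CM-type quadratic extension `E/F` of a
totally real field `F` (`U(J)(F ⊗ ℝ) = Π_{v real} U(p_v, q_v)`), this file CONSTRUCTS the archimedean half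
`s_∞ : U(J)(F ⊗ ℝ) →* Mp_ψ(W_𝔸)ᶜᵒⁿᵗ` of the metaplectic splitting over the restriction-of-scalars embedding
`ι_𝔸 : U(J)(𝔸_F) → Sp(W_𝔸)` ([GelbartRogawski1991] §3.1 p. 454 «the pull-back to `H(𝐀)` of the metaplectic extension
splits»; [Weil1964] Chap. III n° 37–39), with NO choice left open and NO cited hypothesis:

* §1 the trivial junction partner: `U(α, β) = U(α, β) × U(1, 0)` — `toBig (g, 1)` is the relabelling of `g`
  (`toBig_inl_one`), so the junction splitting `weilHomV α β Unit Empty` (`ArchMetaplecticUnitarySplitting`, Folland's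
  `det^{1/2}`-normalised metaplectic section of [Paul1998, (1.2.1)]) lies over `toSp g` up to the relabelling
  `unitJunctionIdx` (`coe_proj_weilHomV_unit`);
* §2 the canonical sign frames of the hermitian space at the real places (`deltaIm`, `signVec`: `σ_v(t₀ j) = im σ_{w(v)}(δ) ·
  signOf · D²`, `ht_signVec`), read off `ArchDualPairThetaMajorants.placeSignVec ∕ signSplit ∕ sqrtAbs`;
* §3 **`archWeilSectionS : U(J)(F ⊗ ℝ) →* Mp^𝓢(ℝ^{Fin N × places})`** — the components `archUForm v` in the sign frames
  (`ArchFollandDualPair`), block-diagonally assembled (`ArchPlaceUnitaryDiagonal.UForm.placeDiag`), pushed through the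
  metaplectic section and relabelled to the coordinates of the scaled Folland frame; its phase action IS the dictionary:
  **`archPhaseMap_eq_coe_proj_archWeilSectionS`**: `archPhaseMap (T ⊗ 1) e_D (ι_𝔸(g, 1)) = ⇑(proj (archWeilSectionS g))`
  (`ArchFollandUnitaryPlaces.archPhaseMap_adelicToSymplectic` + `ArchPlaceUnitaryDiagonal.reindexPhase_twRealify_placeDiagMatrix`);
  its `𝓢`-orbit maps are continuous (`continuous_archWeilSectionS_apply`, from `ArchMetaplecticUnitarySplittingContinuity`);
* §4 **`archWeilHalf : U(J)(F ⊗ ℝ) →* Mp_ψ(W_𝔸)ᶜᵒⁿᵗ`** := `archLift` (`AdelicMetaplecticArchSection`) of §3 over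
  `ι_𝔸 ∘ (g ↦ (g, 1))`, with **`proj_archWeilHalf`** (`proj ∘ s_∞ = ι_𝔸 ∘ archToAdelic`, `rfl`), **`isArch_archWeilHalf`**
  (`ω(s_∞ g) = A_g ⊗ 1`), **`continuous_archWeilHalf`**;
* (sequel `ArchUnitaryWeilHalfQuotient`: Folland's quotient character of the section,
  `quot (archWeilSectionS g) = ∏_v (det g_{w(v)})⁻¹`.)

These are the fields `continuous`, `proj_eq`, `isArch` of the archimedean-half interface `IsArchHalf` of the kernel
construction of [GelbartRogawski1991, Prop. 3.1.1] (stage-1 cell pub-hodgecm, seat GR-3 = own-s1arch; the `parabolic` field —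
the prescribed character on the Siegel parabolic `P_Δ` — is the sequel file).

## References

* [GelbartRogawski1991] S. Gelbart, J. Rogawski, Invent. math. 105 (1991), §3.1 p. 454, Prop. 3.1.1.
* [Weil1964] A. Weil, Acta Math. 111 (1964), Chap. III n° 37–39 pp. 188–190.
* [Paul1998] A. Paul, J. Funct. Anal. 159 (1998), §1.2 (1.2.1).
* [KonnoKonno2007] K. Konno, T. Konno, Kyushu J. Math. 61 (2007), §3.1 (3.1).
* [MoeglinVignerasWaldspurger1987] C. Mœglin, M.-F. Vignéras, J.-L. Waldspurger, LNM 1291 (1987), Ch. 1 I.17, Chap. 2 II.1.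
* [Folland1989] G. B. Folland, *Harmonic Analysis in Phase Space*, Princeton UP 1989, §4.2 (4.23), Prop. (4.39).
-/

set_option autoImplicit false

noncomputable section

open scoped Matrix Real Classical ComplexConjugate Kronecker
open Complex NumberField NumberField.InfinitePlace NumberField.mixedEmbedding IsDedekindDomain
open Literature.NumberTheory.Automorphic Literature.NumberTheory.Automorphic.UnitaryGroup
open Literature.RepresentationTheory.HeisenbergGroup Literature.Analysis.SegalBargmann
open Literature.RepresentationTheory.KonnoKonno2007 Literature.RepresentationTheory.KonnoKonno2007.RealDualPair

namespace Literature.NumberTheory.Weil1964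

open MpS UnitaryWeil


/-! ## §1 The trivial junction partner `U(α, β) × U(1, 0)` -/

section Junction

variable (α β : Type) [Fintype α] [DecidableEq α] [Fintype β] [DecidableEq β]

/-- `α ≃ (α × 1) ⊕ (β × ∅)`. [cite: KonnoKonno2007, §3.1] -/
def junE₁ : α ≃ (α × Unit) ⊕ (β × Empty) := ((Equiv.sumEmpty (α × Unit) (β × Empty)).trans (Equiv.prodPUnit α)).symm

/-- `β ≃ (α × ∅) ⊕ (β × 1)`. [cite: KonnoKonno2007, §3.1] -/
def junE₂ : β ≃ (α × Empty) ⊕ (β × Unit) := ((Equiv.emptySum (α × Empty) (β × Unit)).trans (Equiv.prodPUnit β)).symm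

/-- **the relabelling `α ⊕ β ≃ DPIdx α β 1 ∅`** of the junction with the trivial partner `U(1, 0)`. [cite: KonnoKonno2007, §3.1] -/
def unitJunctionIdx : α ⊕ β ≃ DPIdx α β Unit Empty := Equiv.sumCongr (junE₁ α β) (junE₂ α β)

variable {α β}

omit [Fintype α] [DecidableEq α] [Fintype β] [DecidableEq β] in
/-- `junE₁⁻¹ (inl (a, ⋆)) = a`. [cite: KonnoKonno2007, §3.1] -/
@[simp] theorem junE₁_symm_inl (a : α) (u : Unit) : (junE₁ α β).symm (Sum.inl (a, u)) = a := rfl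

omit [Fintype α] [DecidableEq α] [Fintype β] [DecidableEq β] in
/-- `junE₂⁻¹ (inr (b, ⋆)) = b`. [cite: KonnoKonno2007, §3.1] -/
@[simp] theorem junE₂_symm_inr (b : β) (u : Unit) : (junE₂ α β).symm (Sum.inr (b, u)) = b := rfl

/-- **`toBig (g, 1)` is the relabelling of `g`**: `g ⊗ 1₁ = g` in the block frame. [cite: KonnoKonno2007, §3.1 (3.1);
MoeglinVignerasWaldspurger1987, Ch. 1 I.17] -/
theorem toBig_inl_one (g : UForm α β) :
    toBig α β Unit Empty (g, 1) = UForm.relabel α β _ _ (junE₁ α β) (junE₂ α β) g := by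
  refine Subtype.ext (Units.ext ?_)
  rw [coe_toBig, UForm.coe_relabel]
  have h1 : ((((g, (1 : UForm Unit Empty)) : Ginf α β Unit Empty).2 : GL (Unit ⊕ Empty) ℂ) :
      Matrix (Unit ⊕ Empty) (Unit ⊕ Empty) ℂ) = 1 := rfl
  rw [h1]
  ext x y
  rw [Matrix.reindex_apply, Matrix.reindex_apply, Matrix.submatrix_apply, Matrix.submatrix_apply,
    Matrix.kroneckerMap_apply, Equiv.sumCongr_symm]
  rcases x with ((⟨p, u⟩ | ⟨q, e⟩) | (⟨p, e⟩ | ⟨q, u⟩)) <;> try exact e.elim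
  all_goals rcases y with ((⟨p', u'⟩ | ⟨q', e'⟩) | (⟨p', e'⟩ | ⟨q', u'⟩)) <;> try exact e'.elim
  all_goals simp [Matrix.one_apply]

/-- **the junction splitting over the trivial partner lies over `toSp g`, relabelled**:
`⇑(proj (weilHomV α β 1 ∅ g)) = reindexPhase unitJunctionIdx⁻¹ (twRealify g)`. [cite: KonnoKonno2007, §3.1 (3.1); Paul1998, §1.2 (1.2.1)] -/
theorem coe_proj_weilHomV_unit (g : UForm α β) :
    (⇑((proj (weilHomV α β Unit Empty g)).1 :
        ((DPIdx α β Unit Empty → ℝ) × (DPIdx α β Unit Empty → ℝ)) ≃ₗ[ℝ]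
          ((DPIdx α β Unit Empty → ℝ) × (DPIdx α β Unit Empty → ℝ))) : PhaseMap (DPIdx α β Unit Empty)) =
      reindexPhase (unitJunctionIdx α β).symm (twRealify ((g : GL (α ⊕ β) ℂ) : Matrix (α ⊕ β) (α ⊕ β) ℂ)) := by
  rw [proj_weilHomV]
  show (⇑((UForm.toSp _ _ (toBig α β Unit Empty (g, 1))).1 : ((DPIdx α β Unit Empty → ℝ) × (DPIdx α β Unit Empty → ℝ))
    ≃ₗ[ℝ] ((DPIdx α β Unit Empty → ℝ) × (DPIdx α β Unit Empty → ℝ))) : PhaseMap (DPIdx α β Unit Empty)) = _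
  rw [toBig_inl_one, UForm.toSp_relabel, coe_reindexSp, UForm.coe_toSp]
  rfl

end Junction

/-! ## §2 Composition of relabellings of phase maps -/

section Reindex

variable {σ₁ σ₂ σ₃ : Type*}

/-- `(φ^{E₂})^{E₁} = φ^{E₁ E₂}`. [cite: Weil1964, Chap. I n° 12] -/
theorem reindexPhase_reindexPhase (E₁ : σ₁ ≃ σ₂) (E₂ : σ₂ ≃ σ₃) (φ : PhaseMap σ₃) :
    reindexPhase E₁ (reindexPhase E₂ φ) = reindexPhase (E₁.trans E₂) φ := rfl

end Reindex

/-! ## §3 The canonical sign frames of one hermitian space at the real places -/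

section Frames

variable {F : Type} [Field F] [NumberField F] {E : Type} [Field E] [NumberField E] [Algebra F E]
  (wOf : {v : InfinitePlace F // v.IsReal} → {w : InfinitePlace E // w.IsComplex}) {N : ℕ} (t₀ : Fin N → F) (δ : E)

/-- `c_v := im σ_{w(v)}(δ)`, the scalar of the quadratic coordinate at the real place `v`. [cite: Folland1989, Ch. 4 §1 Prop. (4.6)] -/
def deltaIm (v : {v : InfinitePlace F // v.IsReal}) : ℝ := ((wOf v).1.embedding δ).im

/-- the sign vector `x_v = (σ_v(t₀ j) / c_v)_j` of the place `v`. [cite: KonnoKonno2007, §3.1] -/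
def signVec (v : {v : InfinitePlace F // v.IsReal}) : Fin N → ℝ := placeSignVec t₀ (deltaIm wOf δ) v

variable {wOf t₀ δ}

omit [NumberField F] [NumberField E] in
/-- `c_v ≠ 0`: `σ_w(δ)` is purely imaginary (`re = 0`, `UnitaryGroup.re_embedding_delta`) and non-zero.
[cite: Folland1989, Ch. 4 §1 Prop. (4.6)] -/
theorem deltaIm_ne_zero {c : E ≃ₐ[F] E} (hc : c ≠ 1) (hw : ∀ v, c • (wOf v).1 = (wOf v).1) (hcδ : c δ = -δ) (hδ : δ ≠ 0)
    (v : {v : InfinitePlace F // v.IsReal}) : deltaIm wOf δ v ≠ 0 := by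
  intro h
  have hre := UnitaryGroup.re_embedding_delta F E c (wOf v) (hw v) hc hcδ
  have hz : (wOf v).1.embedding δ = 0 := Complex.ext hre h
  exact hδ ((map_eq_zero_iff _ (wOf v).1.embedding.injective).1 hz)

omit [NumberField F] [NumberField E] in
/-- `x_v j ≠ 0` for non-degenerate `t₀`. [cite: KonnoKonno2007, §3.1] -/
theorem signVec_ne_zero {c : E ≃ₐ[F] E} (hc : c ≠ 1) (hw : ∀ v, c • (wOf v).1 = (wOf v).1) (hcδ : c δ = -δ) (hδ : δ ≠ 0)
    (ht0 : ∀ j, t₀ j ≠ 0) (v : {v : InfinitePlace F // v.IsReal}) (j : Fin N) : signVec wOf t₀ δ v j ≠ 0 :=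
  div_ne_zero ((map_ne_zero _).2 (ht0 j)) (deltaIm_ne_zero hc hw hcδ hδ v)

omit [NumberField F] [NumberField E] in
/-- the scaling does not vanish: `√|x_v j| ≠ 0`. [cite: Folland1989, §1.3 (1.25)] -/
theorem sqrtAbs_signVec_ne_zero {c : E ≃ₐ[F] E} (hc : c ≠ 1) (hw : ∀ v, c • (wOf v).1 = (wOf v).1) (hcδ : c δ = -δ)
    (hδ : δ ≠ 0) (ht0 : ∀ j, t₀ j ≠ 0) (v : {v : InfinitePlace F // v.IsReal}) (j : Fin N) :
    sqrtAbs (signVec wOf t₀ δ v) j ≠ 0 :=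
  sqrtAbs_ne_zero (signVec_ne_zero hc hw hcδ hδ ht0 v j)

omit [NumberField F] [NumberField E] in
/-- **the adapted identity `σ_v(t₀ j) = c_v · signOf(ε_v j) · D_{v,j}²`** in the canonical sign frame
`ε_v = signSplit x_v`, `D_v = √|x_v|`. [cite: KonnoKonno2007, §3.1; Folland1989, Ch. 4 §1 Prop. (4.6)] -/
theorem ht_signVec {c : E ≃ₐ[F] E} (hc : c ≠ 1) (hw : ∀ v, c • (wOf v).1 = (wOf v).1) (hcδ : c δ = -δ) (hδ : δ ≠ 0)
    (ht0 : ∀ j, t₀ j ≠ 0) (v : {v : InfinitePlace F // v.IsReal}) (j : Fin N) :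
    embedding_of_isReal v.2 (t₀ j) =
      deltaIm wOf δ v * signOf (signSplit (signVec wOf t₀ δ v) j) * sqrtAbs (signVec wOf t₀ δ v) j ^ 2 :=
  eq_mul_signOf_signSplit_mul_sqrtAbs_sq (deltaIm_ne_zero hc hw hcδ hδ v) (fun j => embedding_of_isReal v.2 (t₀ j)) j
    ((map_ne_zero _).2 (ht0 j))

end Frames

/-! ## §4 The archimedean section in the scaled Folland frame -/

section ArchSection

variable {F : Type} [Field F] [NumberField F] (E : Type) [Field E] [NumberField E] [Algebra F E] (c : E ≃ₐ[F] E)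
  (N : ℕ) (hc : c ≠ 1)
  (wOf : {v : InfinitePlace F // v.IsReal} → {w : InfinitePlace E // w.IsComplex})
  (hw : ∀ v, c • (wOf v).1 = (wOf v).1) (hover : ∀ v, (wOf v).1.comap (algebraMap F E) = v.1)
  (t₀ : Fin N → F) (ht0 : ∀ j, t₀ j ≠ 0) {T : Matrix (Fin N) (Fin N) F} (hTd : T = Matrix.diagonal t₀)
  {J : Matrix (Fin N) (Fin N) E} (hJ : J = T.map (algebraMap F E)) {δ : E} (hcδ : c δ = -δ) (hδ : δ ≠ 0)

omit [NumberField F] [NumberField E] in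
include hTd hJ in
/-- `J = diag(t₀) ⊗ 1`. [cite: GelbartRogawski1991, §3.1 p. 454] -/
theorem hJ_diagonal : J = (Matrix.diagonal t₀).map (algebraMap F E) := by rw [hJ, hTd]

/-- **the archimedean components in the canonical sign frames**: `g ↦ (archUForm v (g, 1))_v ∈ Π_v U(P_v, Q_v)`.
[cite: MoeglinVignerasWaldspurger1987, Ch. 1 I.17; KonnoKonno2007, §3.1] -/
def archUFormPi : UnitaryGroup.arch F E c N J →*
    ∀ v : {v : InfinitePlace F // v.IsReal}, UForm (PosIdx (signVec wOf t₀ δ v)) (NegIdx (signVec wOf t₀ δ v)) :=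
  MonoidHom.pi fun v =>
    (archUForm E c N hc wOf hw hover t₀ (hJ_diagonal E N t₀ hTd hJ) v (signSplit (signVec wOf t₀ δ v))
      (sqrtAbs_signVec_ne_zero hc hw hcδ hδ ht0 v) (deltaIm_ne_zero hc hw hcδ hδ v)
      (ht_signVec hc hw hcδ hδ ht0 v)).comp (UnitaryGroup.archToAdelic F E c N J)

/-- Unfolding. [cite: KonnoKonno2007, §3.1] -/
theorem archUFormPi_apply (g : UnitaryGroup.arch F E c N J) (v : {v : InfinitePlace F // v.IsReal}) :
    archUFormPi E c N hc wOf hw hover t₀ ht0 hTd hJ hcδ hδ g v =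
      archUForm E c N hc wOf hw hover t₀ (hJ_diagonal E N t₀ hTd hJ) v (signSplit (signVec wOf t₀ δ v))
        (sqrtAbs_signVec_ne_zero hc hw hcδ hδ ht0 v) (deltaIm_ne_zero hc hw hcδ hδ v) (ht_signVec hc hw hcδ hδ ht0 v)
        (UnitaryGroup.archToAdelic F E c N J g) := rfl

/-- `archUFormPi` is continuous. [cite: MoeglinVignerasWaldspurger1987, Ch. 1 I.17] -/
theorem continuous_archUFormPi : Continuous (archUFormPi E c N hc wOf hw hover t₀ ht0 hTd hJ hcδ hδ) :=
  continuous_pi fun v => (continuous_archUForm E c N hc wOf hw hover t₀ (hJ_diagonal E N t₀ hTd hJ) v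
    (signSplit (signVec wOf t₀ δ v)) (sqrtAbs_signVec_ne_zero hc hw hcδ hδ ht0 v) (deltaIm_ne_zero hc hw hcδ hδ v)
    (ht_signVec hc hw hcδ hδ ht0 v)).comp (UnitaryGroup.continuous_archToAdelic F E c N J)

/-- **the coordinates of the scaled Folland frame of `W_∞`**:
`Fin N × places ≃ DPIdx (Σ_v P_v) (Σ_v Q_v) 1 ∅` (sign-sorted, then the trivial junction). [cite: Weil1964, Chap. III n° 37] -/
def archIdx : Fin N × {v : InfinitePlace F // v.IsReal} ≃
    DPIdx (Σ v : {v : InfinitePlace F // v.IsReal}, PosIdx (signVec wOf t₀ δ v))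
      (Σ v : {v : InfinitePlace F // v.IsReal}, NegIdx (signVec wOf t₀ δ v)) Unit Empty :=
  (placeSumIdx fun v => signSplit (signVec wOf t₀ δ v)).trans (unitJunctionIdx _ _)

omit [NumberField F] [NumberField E] [Algebra F E] in
/-- `archIdx ∘ unitJunctionIdx⁻¹ = placeSumIdx`. [cite: Weil1964, Chap. III n° 37] -/
theorem archIdx_trans_symm :
    (archIdx E N wOf t₀ (δ := δ)).trans (unitJunctionIdx _ _).symm = placeSumIdx fun v => signSplit (signVec wOf t₀ δ v) := by
  rw [archIdx, Equiv.trans_assoc, Equiv.self_trans_symm, Equiv.trans_refl]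

/-- **`archWeilSectionS : U(J)(F ⊗ ℝ) →* Mp^𝓢(ℝ^{Fin N × places})`** — Folland's `det^{1/2}`-normalised metaplectic section of
the block-diagonally assembled archimedean components, relabelled to the coordinates of the scaled Folland frame.
[cite: Paul1998, §1.2 (1.2.1); Weil1964, Chap. III n° 37; GelbartRogawski1991, §3.1 p. 454] -/
def archWeilSectionS : UnitaryGroup.arch F E c N J →* MpS (Fin N × {v : InfinitePlace F // v.IsReal}) :=
  (MpS.reindex (archIdx E N wOf t₀ (δ := δ))).comp
    ((weilHomV (Σ v : {v : InfinitePlace F // v.IsReal}, PosIdx (signVec wOf t₀ δ v))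
        (Σ v : {v : InfinitePlace F // v.IsReal}, NegIdx (signVec wOf t₀ δ v)) Unit Empty).comp
      (UForm.placeDiag.comp (archUFormPi E c N hc wOf hw hover t₀ ht0 hTd hJ hcδ hδ)))

/-- Unfolding. [cite: Weil1964, Chap. III n° 37] -/
theorem archWeilSectionS_apply (g : UnitaryGroup.arch F E c N J) :
    archWeilSectionS E c N hc wOf hw hover t₀ ht0 hTd hJ hcδ hδ g =
      MpS.reindex (archIdx E N wOf t₀ (δ := δ)) (weilHomV _ _ Unit Empty
        (UForm.placeDiag (archUFormPi E c N hc wOf hw hover t₀ ht0 hTd hJ hcδ hδ g))) := rfl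

/-- **the `𝓢`-orbit maps of `archWeilSectionS` are continuous.** [cite: Folland1989, §4.2 p. 156; Weil1964, Chap. III n° 39] -/
theorem continuous_archWeilSectionS_apply (f : SchwartzMap ((Fin N × {v : InfinitePlace F // v.IsReal}) → ℝ) ℂ) :
    Continuous fun g : UnitaryGroup.arch F E c N J => (archWeilSectionS E c N hc wOf hw hover t₀ ht0 hTd hJ hcδ hδ g).1.2 f := by
  simp only [archWeilSectionS_apply, MpS.reindex_apply]
  exact (schwartzTransport _).continuous.comp ((continuous_weilHomV_apply _).comp
    (UForm.continuous_placeDiag.comp (continuous_archUFormPi E c N hc wOf hw hover t₀ ht0 hTd hJ hcδ hδ)))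

/-- **the phase action of `archWeilSectionS g` is the slice-by-slice map** `placePhase (v ↦ reindexPhase ε_v (twRealify G_v))`.
[cite: KonnoKonno2007, §3.1 (3.1); Weil1964, Chap. I n° 12, Chap. III n° 37] -/
theorem coe_proj_archWeilSectionS (g : UnitaryGroup.arch F E c N J) :
    (⇑((proj (archWeilSectionS E c N hc wOf hw hover t₀ ht0 hTd hJ hcδ hδ g)).1 :
        ((Fin N × {v : InfinitePlace F // v.IsReal} → ℝ) × (Fin N × {v : InfinitePlace F // v.IsReal} → ℝ)) ≃ₗ[ℝ]
          ((Fin N × {v : InfinitePlace F // v.IsReal} → ℝ) × (Fin N × {v : InfinitePlace F // v.IsReal} → ℝ))) :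
        PhaseMap (Fin N × {v : InfinitePlace F // v.IsReal})) =
      placePhase fun v => reindexPhase (signSplit (signVec wOf t₀ δ v))
        (twRealify (((archUFormPi E c N hc wOf hw hover t₀ ht0 hTd hJ hcδ hδ g v : UForm _ _) :
          GL (PosIdx (signVec wOf t₀ δ v) ⊕ NegIdx (signVec wOf t₀ δ v)) ℂ) : Matrix _ _ ℂ)) := by
  have h1 : proj (archWeilSectionS E c N hc wOf hw hover t₀ ht0 hTd hJ hcδ hδ g) =
      reindexSp (archIdx E N wOf t₀ (δ := δ)) (proj (weilHomV _ _ Unit Empty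
        (UForm.placeDiag (archUFormPi E c N hc wOf hw hover t₀ ht0 hTd hJ hcδ hδ g)))) := rfl
  rw [h1, coe_reindexSp, coe_proj_weilHomV_unit, reindexPhase_reindexPhase, archIdx_trans_symm, UForm.coe_placeDiag,
    reindexPhase_twRealify_placeDiagMatrix]

variable [IsTotallyReal F] [Algebra.IsQuadraticExtension F E] {d : F} (hd : δ * δ = algebraMap F E d)

/-- **THE DICTIONARY HOLDS FOR `archWeilSectionS`**: in the scaled Folland frame `e_D` (`D_{(j,v)} = √|σ_v(t₀ j)/c_v|`),
the archimedean phase map of `ι_𝔸(g, 1)` is the phase action of `archWeilSectionS g`. [cite: GelbartRogawski1991, §3.1 p. 454;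
KonnoKonno2007, §3.1 (3.1); Folland1989, Ch. 4 §1 Prop. (4.6)] -/
theorem archPhaseMap_eq_coe_proj_archWeilSectionS (hT : T.IsSymm)
    (hTu : IsUnit (archMat F (Fin N) (T.map (algebraMap F (AdeleRing (𝓞 F) F))))) (g : UnitaryGroup.arch F E c N J) :
    archPhaseMap (T.map (algebraMap F (AdeleRing (𝓞 F) F)))
        (scaledFrame F (Fin N) (placeScale N fun v => sqrtAbs (signVec wOf t₀ δ v))
          (placeScale_ne_zero N (sqrtAbs_signVec_ne_zero hc hw hcδ hδ ht0))) hTu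
        (((adelicToSymplectic F E c N hcδ hδ hd hT hJ).comp (UnitaryGroup.archToAdelic F E c N J)) g) =
      ⇑((proj (archWeilSectionS E c N hc wOf hw hover t₀ ht0 hTd hJ hcδ hδ g)).1 :
        ((Fin N × {v : InfinitePlace F // v.IsReal} → ℝ) × (Fin N × {v : InfinitePlace F // v.IsReal} → ℝ)) ≃ₗ[ℝ]
          ((Fin N × {v : InfinitePlace F // v.IsReal} → ℝ) × (Fin N × {v : InfinitePlace F // v.IsReal} → ℝ))) := by
  subst hTd
  rw [coe_proj_archWeilSectionS, MonoidHom.comp_apply,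
    archPhaseMap_adelicToSymplectic E c N hc wOf hw hover t₀ hJ (fun v => signSplit (signVec wOf t₀ δ v))
      (sqrtAbs_signVec_ne_zero hc hw hcδ hδ ht0) (deltaIm_ne_zero hc hw hcδ hδ) (ht_signVec hc hw hcδ hδ ht0)
      hcδ hδ hd hT (fun v => rfl) hTu]
  rfl

omit [IsTotallyReal F] in
/-- `ι_𝔸(g, 1)` fixes the finite vectors (hypothesis `hj` of `archLift`). [cite: BorelJacquet1979, §4.1] -/
theorem adelicToSymplectic_comp_archToAdelic_finVec (hT : T.IsSymm) (g : UnitaryGroup.arch F E c N J)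
    (k c' : Fin N → FiniteAdeleRing (𝓞 F) F) :
    (((adelicToSymplectic F E c N hcδ hδ hd hT hJ).comp (UnitaryGroup.archToAdelic F E c N J)) g).1 (finVec k, finVec c') =
      (finVec k, finVec c') :=
  adelicToSymplectic_archToAdelic_finVec F E c N hcδ hδ hd hT hJ g k c'

/-! ## §5 The archimedean half `s_∞ : U(J)(F ⊗ ℝ) →* Mp_ψ(W_𝔸)ᶜᵒⁿᵗ` -/

/-- **`archWeilHalf : U(J)(F ⊗ ℝ) →* Mp_ψ(W_𝔸)ᶜᵒⁿᵗ`**, `g ↦ (ι_𝔸(g, 1), (e_D^* s(g) e_{D*}) ⊗ 1)` — the archimedean half of the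
metaplectic splitting of `U(J)(𝔸_F)`. [cite: GelbartRogawski1991, §3.1 p. 454, Prop. 3.1.1; Weil1964, Chap. III n° 37–39] -/
def archWeilHalf (hT : T.IsSymm) (hTu : IsUnit (archMat F (Fin N) (T.map (algebraMap F (AdeleRing (𝓞 F) F))))) :
    UnitaryGroup.arch F E c N J →* adelicMpCont F (Fin N) (T.map (algebraMap F (AdeleRing (𝓞 F) F))) :=
  archLift (T.map (algebraMap F (AdeleRing (𝓞 F) F)))
    (scaledFrame F (Fin N) (placeScale N fun v => sqrtAbs (signVec wOf t₀ δ v))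
      (placeScale_ne_zero N (sqrtAbs_signVec_ne_zero hc hw hcδ hδ ht0))) hTu
    ((adelicToSymplectic F E c N hcδ hδ hd hT hJ).comp (UnitaryGroup.archToAdelic F E c N J))
    (archWeilSectionS E c N hc wOf hw hover t₀ ht0 hTd hJ hcδ hδ)
    (adelicToSymplectic_comp_archToAdelic_finVec E c N hJ hcδ hδ hd hT)
    (archPhaseMap_eq_coe_proj_archWeilSectionS E c N hc wOf hw hover t₀ ht0 hTd hJ hcδ hδ hd hT hTu)

/-- **`proj (s_∞ g) = ι_𝔸(g, 1)`** (field `proj_eq` of the archimedean-half interface). [cite: GelbartRogawski1991, §3.1 p. 454] -/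
@[simp] theorem proj_archWeilHalf (hT : T.IsSymm) (hTu : IsUnit (archMat F (Fin N) (T.map (algebraMap F (AdeleRing (𝓞 F) F)))))
    (g : UnitaryGroup.arch F E c N J) :
    adelicMpCont.proj F (Fin N) _ (archWeilHalf E c N hc wOf hw hover t₀ ht0 hTd hJ hcδ hδ hd hT hTu g) =
      adelicToSymplectic F E c N hcδ hδ hd hT hJ (UnitaryGroup.archToAdelic F E c N J g) := rfl

/-- **`ω(s_∞ g) = A_g ⊗ 1` is archimedean** (field `isArch`). [cite: Weil1964, Chap. III n° 38 p. 189] -/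
theorem isArch_archWeilHalf (hT : T.IsSymm) (hTu : IsUnit (archMat F (Fin N) (T.map (algebraMap F (AdeleRing (𝓞 F) F)))))
    (g : UnitaryGroup.arch F E c N J) :
    ∃ A : SchwartzMap (Fin N → mixedSpace F) ℂ →L[ℂ] SchwartzMap (Fin N → mixedSpace F) ℂ,
      (adelicMpCont.omega F (Fin N) _ (archWeilHalf E c N hc wOf hw hover t₀ ht0 hTd hJ hcδ hδ hd hT hTu g) :
          piSchwartzBruhat F (Fin N) →ₗ[ℂ] piSchwartzBruhat F (Fin N)) =
        adelicTensorEnd (A : SchwartzMap (Fin N → mixedSpace F) ℂ →ₗ[ℂ] SchwartzMap (Fin N → mixedSpace F) ℂ) LinearMap.id :=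
  isArch_archLift _ _ _ _ _ _ _ g

/-- the archimedean operator of `s_∞ g` explicitly: `e_D^* ∘ (archWeilSectionS g) ∘ e_{D*}`. [cite: Weil1964, Chap. III n° 38 p. 189] -/
theorem omega_archWeilHalf (hT : T.IsSymm) (hTu : IsUnit (archMat F (Fin N) (T.map (algebraMap F (AdeleRing (𝓞 F) F)))))
    (g : UnitaryGroup.arch F E c N J) :
    (adelicMpCont.omega F (Fin N) _ (archWeilHalf E c N hc wOf hw hover t₀ ht0 hTd hJ hcδ hδ hd hT hTu g) :
        piSchwartzBruhat F (Fin N) →ₗ[ℂ] piSchwartzBruhat F (Fin N)) =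
      adelicTensorEnd ((carrierConjEquiv
          (scaledFrame F (Fin N) (placeScale N fun v => sqrtAbs (signVec wOf t₀ δ v))
            (placeScale_ne_zero N (sqrtAbs_signVec_ne_zero hc hw hcδ hδ ht0)))
          (archWeilSectionS E c N hc wOf hw hover t₀ ht0 hTd hJ hcδ hδ g).1.2 :
          SchwartzMap (Fin N → mixedSpace F) ℂ →L[ℂ] SchwartzMap (Fin N → mixedSpace F) ℂ) :
        SchwartzMap (Fin N → mixedSpace F) ℂ →ₗ[ℂ] SchwartzMap (Fin N → mixedSpace F) ℂ) LinearMap.id :=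
  rfl

/-- **`s_∞` is continuous** (field `continuous`): the `π`-orbit maps of `ι_𝔸` and the `𝓢`-orbit maps of the metaplectic
section are. [cite: Weil1964, Chap. III n° 39 p. 189; Folland1989, §4.2 p. 156] -/
theorem continuous_archWeilHalf (hT : T.IsSymm) (hTu : IsUnit (archMat F (Fin N) (T.map (algebraMap F (AdeleRing (𝓞 F) F))))) :
    Continuous (archWeilHalf E c N hc wOf hw hover t₀ ht0 hTd hJ hcδ hδ hd hT hTu) :=
  continuous_archLift _ _ _ _ _ _ _
    (fun w => (continuous_adelicToSymplectic_apply F E c (N := N) hcδ hδ hd hT hJ w).comp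
      (UnitaryGroup.continuous_archToAdelic F E c N J))
    (continuous_archWeilSectionS_apply E c N hc wOf hw hover t₀ ht0 hTd hJ hcδ hδ)

end ArchSection

end Literature.NumberTheory.Weil1964

end
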